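import Mathlib.MeasureTheory.Measure.Haar.Basic
import Mathlib.MeasureTheory.Group.Action
import Mathlib.MeasureTheory.Group.Integral
import Mathlib.MeasureTheory.Measure.Prod
import Mathlib.MeasureTheory.Integral.Prod
import Mathlib.MeasureTheory.Integral.DominatedConvergence
import Mathlib.MeasureTheory.Function.LpSeminorm.CompareExp
import Mathlib.MeasureTheory.Function.LpSpace.Basic
import Mathlib.MeasureTheory.Function.LpSpace.DomAct.Basic
import Mathlib.MeasureTheory.Function.L2Space
import Mathlib.MeasureTheory.Function.AEEqOfIntegral
import Mathlib.Topology.Algebra.Group.Quotient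
import HarnessLib

/-!
# Domination of orbit integrals by a finite invariant measure; orbital smoothing

Trunk `AutomorphicAxiomatic` (G19), topic `NumberTheory/Automorphic`; namespace `Literature.Automorphic`.
Abstract measure theory (Mathlib only), written for the automorphic quotient
`X = G(𝔸_K) ⧸ (A_G · G(K))` of `AdelicGroupData` with a measure `μ` subject *only* to the four
axioms of `AdelicGroupData.IsAutomorphicMeasure` (finite, positive on non-empty open sets,
inner regular, `G(𝔸_K)`-invariant) — in particular **without** knowing that `μ` is the quotient of a
Haar measure (the named fact `isAutomorphicMeasure_unique_smul` is not used).

## Setting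

A group `G` acts on a space `X`; `μ` is a finite measure on `X` which is invariant under the action
and positive on non-empty open sets; `ν` is a left-invariant measure on `G`, finite on compact sets
(a left Haar measure); `x₀ ∈ X` is a point whose orbit map `g ↦ g • x₀` is open (every point of a
coset space `G ⧸ H`, `isOpenMap_smul_quotient`). Write `A_x(E) = {h ∈ G | h⁻¹ • x ∈ E}`
(`invOrbitPreimage x E`).

## Main results (all proved)

* `lintegral_measure_inter_invOrbitPreimage` — the **averaging identity**
  `∫_X ν(B ∩ A_x(E)) dμ(x) = ν(B) μ(E)` (Tonelli and invariance of `μ`).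
* `exists_measure_inter_invOrbitPreimage_le` — **domination**: for every compact `D ⊆ G` there is
  `C < ∞` with `ν(D ∩ A_{x₀}(E)) ≤ C μ(E)` for all measurable `E`. Proof: `A_{b • x₀}(E) =
  b · A_{x₀}(E)`, so for `x = b • x₀` with `b` in a compact neighbourhood `B'` of `1`,
  left invariance gives `ν(D ∩ A_{x₀}(E)) ≤ ν(B'D ∩ A_x(E))`; average over the open set
  `U = B'° • x₀` (of positive `μ`-measure) and use the averaging identity. No modular function, no
  unimodularity, no regularity of `μ` and no Hausdorff hypothesis on `X` are needed.
* `measure_invOrbitPreimage_eq_zero` — for `σ`-compact `G`, `μ`-null sets pull back to `ν`-null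
  sets along the whole orbit.
* `lintegral_inv_smul_le`, `lintegral_smul_inv_smul_le`, `exists_lintegral_smul_inv_smul_le`,
  `integral_smul_inv_smul_le` — the integral forms
  `∫_D F(θ h⁻¹ • x₀) dν(h) ≤ C ∫_X F dμ`, **uniformly in `θ ∈ G`** (the constant of `D` serves all
  left translates, by invariance of `μ`); `MemLp.comp_inv_smul`, `Integrable.comp_inv_smul` —
  `L^p(μ)`-functions are `L^p` along orbits, locally on `G`.
* `orbitalSmoothing ν η f (x) = ∫_G η(g) f(g⁻¹ • x) dν(g)` for a weight `η ∈ C_c(G)`: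
  `continuous_orbitalSmoothing` (**continuity** for `f ∈ L¹(μ)`, dominated convergence through the
  domination lemma), `integrable_orbitalSmoothing` (`‖S_η f‖₁ ≤ ‖η‖₁ ‖f‖₁`),
  `orbitalSmoothing_congr_ae` (`S_η f (x)` does not see `μ`-null modifications of `f`, at *every*
  point of an open orbit), `integral_mul_orbitalSmoothing` (the **pairing identity**
  `∫ ψ · S_η f dμ = ∫ η(g) ∫ ψ(x) f(g⁻¹ • x) dμ dν` for `f, ψ ∈ L²(μ)`), and
  `coeFn_integral_smul_domSMul_ae_eq`: the `L²(μ)`-valued Bochner integral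
  `∫ η(g) • (g · f) dν(g)` of Mathlib's domain action (`(g · f)(x) = f(g⁻¹ • x)`, the regular
  representation `AdelicGroupData.rightRegular` of `AutomorphicSpectrum`) has `S_η f` as a
  representative.

## Why (the use in the Jacquet–Shalika programme)

For a cuspidal automorphic representation `Π ⊆ L²_cusp(X, μ)` of `GL_n(𝔸_K)` the vectors are
`L²`-classes. The results above produce, from a non-zero `K(𝔫)`-fixed Hecke eigenvector `f ∈ Π`,
the *continuous* function `S_η f` in the same closed invariant subspace (via
`coeFn_integral_smul_domSMul_ae_eq`), and bound every "Siegel-type" region integral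
`∫ |S_η f(θ h⁻¹ • x₀)|² dρ` by `C · ρ(region) · ‖f‖²_{L²(μ)}` for *any* finite superposition `ρ` of
translates of `ν|_D` — the soft substitute for the reduction-theoretic covering lemma in the
Rankin–Selberg / mean-square method towards Jacquet–Shalika, *On Euler products and the
classification of automorphic representations I*, Amer. J. Math. 103 (1981), Lemma (5.2) and
Thm. (5.3), pp. 554–557 (the remaining input of `StandardLFunctionData.multipliable_L`, see
`SatakeParameterTrivialBound`). Everything here is standard measure theory on homogeneous spaces
(quasi-invariance of the invariant measure class); we know no printed source stating the
domination inequality in this axiomatic form, so all declarations are tagged folklore.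

## Mathlib

Used: `SMulInvariantMeasure`, `measure_preimage_smul`, `measurePreserving_smul`,
`Measure.prod_apply`/`prod_apply_symm`, `measure_preimage_mul` (left invariance),
`IsCompact.measure_lt_top`, `IsOpen.measure_pos`, `continuousAt_of_dominated`,
`integrable_prod_iff'`, `integral_integral_swap`, `eLpNorm_le_eLpNorm_mul_eLpNorm'_of_norm`
(Hölder), `DomMulAct.smul_Lp_ae_eq`, `L2.inner_indicatorConstLp_one`, `integral_inner`,
`Integrable.ae_eq_of_forall_setIntegral_eq`, `QuotientGroup.isOpenMap_coe`. Mathlib has the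
quotient-measure theory of `MeasureTheory.Measure.Haar.Quotient` (fundamental domains of
*discrete* subgroups, `QuotientMeasureEqMeasurePreimage`) and `MeasureTheory.Measure.
modularCharacter`, but no comparison between an abstract invariant measure on a homogeneous space
and Haar measure on the group (checked: `lean search 'invOrbit|orbitalSmoothing|IsOpenMap.*smul'`).
-/

noncomputable section

open MeasureTheory Measure Set Filter Topology
open scoped ENNReal NNReal Pointwise

namespace Literature.NumberTheory.Automorphic

/-! ### The sets `A_x(E) = {h | h⁻¹ • x ∈ E}` -/

section InvOrbitPreimage

variable {G X : Type*} [Group G] [MulAction G X]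

/-- The set `A_x(E) = {h ∈ G | h⁻¹ • x ∈ E}` of group elements whose *inverse* moves `x` into `E`:
the preimage of `E` under `h ↦ h⁻¹ • x`. With the inverse, base change is a *left* translation
(`invOrbitPreimage_smul`), which is what a *left* Haar measure sees. [folklore] -/
def invOrbitPreimage (x : X) (E : Set X) : Set G := (fun h : G => h⁻¹ • x) ⁻¹' E

/-- Membership in `A_x(E)` (definitional). [folklore] -/
theorem mem_invOrbitPreimage {x : X} {E : Set X} {h : G} :
    h ∈ invOrbitPreimage x E ↔ h⁻¹ • x ∈ E := Iff.rfl

/-- **Base change is a left translation**: `A_{b • x}(E) = b · A_x(E)`, written as the preimage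
under `h ↦ b⁻¹ h`. [folklore] -/
theorem invOrbitPreimage_smul (b : G) (x : X) (E : Set X) :
    invOrbitPreimage (b • x) E = (fun h : G => b⁻¹ * h) ⁻¹' invOrbitPreimage x E := by
  ext h
  simp only [mem_invOrbitPreimage, mem_preimage, mul_inv_rev, inv_inv, mul_smul]

/-- Translating the target set is a right translation: `A_x(g • E) = A_x(E) · g⁻¹`. [folklore] -/
theorem invOrbitPreimage_smul_set (x : X) (g : G) (E : Set X) :
    invOrbitPreimage x (g • E) = (invOrbitPreimage x E) * ({g⁻¹} : Set G) := by
  ext h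
  simp only [mem_invOrbitPreimage, mul_singleton, mem_image, Set.mem_smul_set_iff_inv_smul_mem,
    smul_smul]
  constructor
  · intro hh; exact ⟨h * g, by simpa [mul_inv_rev] using hh, by simp⟩
  · rintro ⟨k, hk, rfl⟩; simpa [mul_inv_rev] using hk

variable [MeasurableSpace G] [MeasurableInv G] [MeasurableSpace X] [MeasurableSMul₂ G X]

/-- `h ↦ h⁻¹ • x` is measurable. [folklore] -/
theorem measurable_inv_smul_const (x : X) : Measurable fun h : G => h⁻¹ • x :=
  (measurable_smul.comp (measurable_inv.prodMk measurable_const) : _)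

/-- `A_x(E)` is measurable for measurable `E`. [folklore] -/
theorem measurableSet_invOrbitPreimage (x : X) {E : Set X} (hE : MeasurableSet E) :
    MeasurableSet (invOrbitPreimage x E : Set G) :=
  measurable_inv_smul_const x hE

end InvOrbitPreimage

/-! ### The averaging identity -/

section Averaging

variable {G X : Type*} [Group G] [MulAction G X]
  [MeasurableSpace G] [MeasurableInv G] [MeasurableSpace X] [MeasurableSMul₂ G X]
  (μ : Measure X) (ν : Measure G) [SFinite μ] [SFinite ν] [SMulInvariantMeasure G X μ]

/-- **Averaging identity.** For an invariant measure `μ` on `X` and any s-finite measure `ν` on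
`G`: `∫_X ν(B ∩ A_x(E)) dμ(x) = ν(B) μ(E)` — both sides are the `ν ⊗ μ`-measure of
`{(h, x) | h ∈ B, h⁻¹ • x ∈ E}` (Tonelli), the fibre over `h` having measure `μ(h • E) = μ(E)`.
[folklore] -/
theorem lintegral_measure_inter_invOrbitPreimage {B : Set G} (hB : MeasurableSet B) {E : Set X}
    (hE : MeasurableSet E) :
    ∫⁻ x, ν (B ∩ invOrbitPreimage x E) ∂μ = ν B * μ E := by
  set S : Set (G × X) := {p | p.1 ∈ B ∧ p.1⁻¹ • p.2 ∈ E} with hS_def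
  have hmeas : Measurable fun p : G × X => p.1⁻¹ • p.2 :=
    measurable_smul.comp ((measurable_inv.comp measurable_fst).prodMk measurable_snd)
  have hS : MeasurableSet S := (measurable_fst hB).inter (hmeas hE)
  have h1 : (ν.prod μ) S = ∫⁻ h, μ (Prod.mk h ⁻¹' S) ∂ν := prod_apply hS
  have h2 : (ν.prod μ) S = ∫⁻ x, ν ((fun h => (h, x)) ⁻¹' S) ∂μ := prod_apply_symm hS
  have h3 : ∀ x, (fun h : G => (h, x)) ⁻¹' S = B ∩ invOrbitPreimage x E := by
    intro x; ext h; simp [hS_def, mem_invOrbitPreimage]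
  have h4 : ∀ h, μ (Prod.mk h ⁻¹' S) = B.indicator (fun _ => μ E) h := by
    intro h
    by_cases hh : h ∈ B
    · simp only [indicator_of_mem hh]
      have : Prod.mk h ⁻¹' S = (fun x : X => h⁻¹ • x) ⁻¹' E := by
        ext x; simp [hS_def, hh]
      rw [this, measure_preimage_smul]
    · simp only [indicator_of_notMem hh]
      have : Prod.mk h ⁻¹' S = ∅ := by ext x; simp [hS_def, hh]
      rw [this, measure_empty]
  simp_rw [h3] at h2
  simp_rw [h4] at h1
  rw [← h2, h1, lintegral_indicator hB, setLIntegral_const, mul_comm]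

end Averaging

/-! ### Domination of the orbital pushforward of `ν` by `μ` -/

section Domination

variable {G X : Type*} [Group G] [TopologicalSpace G] [IsTopologicalGroup G]
  [MeasurableSpace G] [BorelSpace G]
  [MulAction G X] [MeasurableSpace X] [MeasurableSMul₂ G X]
  (μ : Measure X) (ν : Measure G)

section Measure

variable [TopologicalSpace X] [OpensMeasurableSpace X]
  [IsFiniteMeasure μ] [SFinite ν] [SMulInvariantMeasure G X μ]
  [μ.IsOpenPosMeasure] [ν.IsMulLeftInvariant] [IsFiniteMeasureOnCompacts ν]

/-- **Domination at a base point.** Let `μ` be finite, invariant and positive on non-empty open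
sets, `ν` left invariant and finite on compacts, and let the orbit map of `x₀` be open. Then for
every compact `D ⊆ G` there is a finite `C` with `ν(D ∩ A_{x₀}(E)) ≤ C μ(E)` for all measurable
`E ⊆ X`: the pushforward of `ν|_D` under `h ↦ h⁻¹ • x₀` is dominated by `μ`. (Proof in the module
docstring; `C = ν(closure (B' D)) / μ(B'° • x₀)` for a compact neighbourhood `B'` of `1`.)
[folklore] -/
theorem exists_measure_inter_invOrbitPreimage_le [LocallyCompactSpace G] {x₀ : X}
    (hx₀ : IsOpenMap fun g : G => g • x₀) {D : Set G} (hD : IsCompact D) :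
    ∃ C : ℝ≥0∞, C ≠ ∞ ∧ ∀ E : Set X, MeasurableSet E →
      ν (D ∩ invOrbitPreimage x₀ E) ≤ C * μ E := by
  obtain ⟨B', hB'c, hB'1⟩ := exists_compact_mem_nhds (1 : G)
  set U : Set X := (fun g : G => g • x₀) '' interior B' with hU_def
  have hUo : IsOpen U := hx₀ _ isOpen_interior
  have hUne : U.Nonempty := ⟨(1 : G) • x₀, 1, mem_interior_iff_mem_nhds.2 hB'1, rfl⟩
  have hUpos : μ U ≠ 0 := (hUo.measure_pos μ hUne).ne'
  have hUtop : μ U ≠ ∞ := measure_ne_top μ U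
  set B : Set G := closure (B' * D) with hB_def
  have hBc : IsCompact B := (hB'c.mul hD).closure
  have hBtop : ν B ≠ ∞ := hBc.measure_lt_top.ne
  have hBm : MeasurableSet B := isClosed_closure.measurableSet
  refine ⟨ν B / μ U, ENNReal.div_ne_top hBtop hUpos, fun E hE => ?_⟩
  -- the pointwise inequality on `U`, by left invariance of `ν`
  have hkey : ∀ x ∈ U, ν (D ∩ invOrbitPreimage x₀ E) ≤ ν (B ∩ invOrbitPreimage x E) := by
    rintro _ ⟨b, hb, rfl⟩
    have hbB' : b ∈ B' := interior_subset hb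
    rw [invOrbitPreimage_smul]
    calc ν (D ∩ invOrbitPreimage x₀ E)
        = ν ((fun h : G => b⁻¹ * h) ⁻¹' (D ∩ invOrbitPreimage x₀ E)) :=
          (measure_preimage_mul ν b⁻¹ _).symm
      _ ≤ ν (B ∩ (fun h : G => b⁻¹ * h) ⁻¹' invOrbitPreimage x₀ E) := by
          refine measure_mono fun h hh => ⟨subset_closure ?_, hh.2⟩
          exact ⟨b, hbB', b⁻¹ * h, hh.1, by simp⟩
  -- average over `U`
  calc ν (D ∩ invOrbitPreimage x₀ E)
      = (ν (D ∩ invOrbitPreimage x₀ E) * μ U) / μ U := by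
        rw [mul_div_assoc, ENNReal.div_self hUpos hUtop, mul_one]
    _ = (∫⁻ _ in U, ν (D ∩ invOrbitPreimage x₀ E) ∂μ) / μ U := by
        rw [setLIntegral_const]
    _ ≤ (∫⁻ x in U, ν (B ∩ invOrbitPreimage x E) ∂μ) / μ U :=
        ENNReal.div_le_div_right (setLIntegral_mono' hUo.measurableSet hkey) _
    _ ≤ (∫⁻ x, ν (B ∩ invOrbitPreimage x E) ∂μ) / μ U :=
        ENNReal.div_le_div_right (setLIntegral_le_lintegral _ _) _
    _ = ν B * μ E / μ U := by
        rw [lintegral_measure_inter_invOrbitPreimage μ ν hBm hE]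
    _ = ν B / μ U * μ E := ENNReal.mul_div_right_comm

/-- **Null sets pull back to null sets along open orbits** (`σ`-compact `G`): if `μ E = 0` then
`ν(A_{θ • x₀}(E)) = 0` for every point `θ • x₀` of the orbit of a point `x₀` with open orbit map.
[folklore] -/
theorem measure_invOrbitPreimage_eq_zero [LocallyCompactSpace G] [SigmaCompactSpace G] {x₀ : X}
    (hx₀ : IsOpenMap fun g : G => g • x₀) (θ : G) {E : Set X} (hE : MeasurableSet E)
    (hE0 : μ E = 0) : ν (invOrbitPreimage (θ • x₀) E) = 0 := by
  rw [invOrbitPreimage_smul, measure_preimage_mul]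
  have hcov : invOrbitPreimage x₀ E ⊆ ⋃ n, compactCovering G n ∩ invOrbitPreimage x₀ E := by
    intro h hh
    obtain ⟨n, hn⟩ := exists_mem_compactCovering h
    exact Set.mem_iUnion.2 ⟨n, hn, hh⟩
  refine measure_mono_null hcov (measure_iUnion_null fun n => ?_)
  obtain ⟨C, -, hC⟩ :=
    exists_measure_inter_invOrbitPreimage_le μ ν hx₀ (isCompact_compactCovering G n)
  exact le_antisymm ((hC E hE).trans (by rw [hE0, mul_zero])) bot_le

end Measure

end Domination

section DominationIntegral

variable {G X : Type*} [Group G] [MeasurableSpace G] [MeasurableInv G]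
  [MulAction G X] [MeasurableSpace X] [MeasurableSMul₂ G X]
  (μ : Measure X) (ν : Measure G)

/-- Measure domination as an inequality of measures:
`(ν|_D).map (h ↦ h⁻¹ • x₀) ≤ C • μ`. [folklore] -/
theorem map_restrict_inv_smul_le {x₀ : X} {D : Set G} {C : ℝ≥0∞}
    (h : ∀ E : Set X, MeasurableSet E → ν (D ∩ invOrbitPreimage x₀ E) ≤ C * μ E) :
    (ν.restrict D).map (fun h : G => h⁻¹ • x₀) ≤ C • μ := by
  refine Measure.le_intro fun E hE _ => ?_
  rw [map_apply (measurable_inv_smul_const x₀) hE,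
    Measure.restrict_apply (measurable_inv_smul_const x₀ hE), Measure.smul_apply, smul_eq_mul,
    inter_comm]
  exact h E hE

/-- **Domination of orbit integrals (base point)**: `∫_D F(h⁻¹ • x₀) dν(h) ≤ C ∫_X F dμ` for
measurable `F ≥ 0`, given measure domination on `D`. [folklore] -/
theorem lintegral_inv_smul_le {x₀ : X} {D : Set G} {C : ℝ≥0∞}
    (h : ∀ E : Set X, MeasurableSet E → ν (D ∩ invOrbitPreimage x₀ E) ≤ C * μ E)
    {F : X → ℝ≥0∞} (hF : Measurable F) :
    ∫⁻ g in D, F (g⁻¹ • x₀) ∂ν ≤ C * ∫⁻ x, F x ∂μ := by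
  calc ∫⁻ g in D, F (g⁻¹ • x₀) ∂ν
      = ∫⁻ x, F x ∂((ν.restrict D).map (fun h : G => h⁻¹ • x₀)) :=
        (lintegral_map hF (measurable_inv_smul_const x₀)).symm
    _ ≤ ∫⁻ x, F x ∂(C • μ) := lintegral_mono' (map_restrict_inv_smul_le μ ν h) le_rfl
    _ = C * ∫⁻ x, F x ∂μ := lintegral_smul_measure _ _

/-- **Domination of orbit integrals, uniformly over left translates**:
`∫_D F(θ h⁻¹ • x₀) dν(h) ≤ C ∫_X F dμ` for every `θ ∈ G`, with the constant `C` of `D` at the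
base point (invariance of `μ` under `θ`). Integrating `θ` against any finite measure gives the same
bound for every finite superposition of translates of `ν|_D` — the form in which "Siegel-type"
region integrals of `|φ|²` are bounded by `‖φ‖²_{L²(μ)}`. [folklore] -/
theorem lintegral_smul_inv_smul_le [SMulInvariantMeasure G X μ] {x₀ : X} {D : Set G} {C : ℝ≥0∞}
    (h : ∀ E : Set X, MeasurableSet E → ν (D ∩ invOrbitPreimage x₀ E) ≤ C * μ E)
    {F : X → ℝ≥0∞} (hF : Measurable F) (θ : G) :
    ∫⁻ g in D, F (θ • g⁻¹ • x₀) ∂ν ≤ C * ∫⁻ x, F x ∂μ := by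
  have hmeas : Measurable fun x : X => F (θ • x) := hF.comp (measurable_const_smul θ)
  calc ∫⁻ g in D, F (θ • g⁻¹ • x₀) ∂ν ≤ C * ∫⁻ x, F (θ • x) ∂μ :=
        lintegral_inv_smul_le μ ν h hmeas
    _ = C * ∫⁻ x, F x ∂μ := by
        rw [(measurePreserving_smul θ μ).lintegral_comp hF]

/-- Real-valued form of the domination of orbit integrals, for integrable `F ≥ 0`:
`∫_D F(θ h⁻¹ • x₀) dν(h) ≤ C ∫_X F dμ`. [folklore] -/
theorem integral_smul_inv_smul_le [SMulInvariantMeasure G X μ] {x₀ : X} {D : Set G} {C : ℝ≥0∞}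
    (hC : C ≠ ∞)
    (h : ∀ E : Set X, MeasurableSet E → ν (D ∩ invOrbitPreimage x₀ E) ≤ C * μ E)
    {F : X → ℝ} (hF : Measurable F) (hF0 : 0 ≤ F) (hFi : Integrable F μ) (θ : G) :
    ∫ g in D, F (θ • g⁻¹ • x₀) ∂ν ≤ C.toReal * ∫ x, F x ∂μ := by
  have hmeas : Measurable fun g : G => F (θ • g⁻¹ • x₀) :=
    hF.comp ((measurable_const_smul θ).comp (measurable_inv_smul_const x₀))
  have key := lintegral_smul_inv_smul_le μ ν h (hF.ennreal_ofReal) θ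
  rw [integral_eq_lintegral_of_nonneg_ae (Eventually.of_forall fun x => hF0 _)
      hF.aestronglyMeasurable,
    integral_eq_lintegral_of_nonneg_ae (μ := ν.restrict D) (Eventually.of_forall fun g => hF0 _)
      hmeas.aestronglyMeasurable, ← ENNReal.toReal_mul]
  exact ENNReal.toReal_mono (ENNReal.mul_ne_top hC hFi.lintegral_lt_top.ne) key

/-- **`L^p(μ)`-functions are `L^p` along orbits, locally on `G`** (given measure domination on
`D`): `h ↦ f(h⁻¹ • x₀)` is in `L^p(ν|_D)`. [folklore] -/
theorem MemLp.comp_inv_smul {x₀ : X} {D : Set G} {C : ℝ≥0∞} (hC : C ≠ ∞)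
    (h : ∀ E : Set X, MeasurableSet E → ν (D ∩ invOrbitPreimage x₀ E) ≤ C * μ E)
    {E' : Type*} [NormedAddCommGroup E'] {p : ℝ≥0∞} {f : X → E'} (hf : MemLp f p μ) :
    MemLp (fun g : G => f (g⁻¹ • x₀)) p (ν.restrict D) := by
  have h1 : MemLp f p (C • μ) := hf.smul_measure hC
  have h2 : MemLp f p ((ν.restrict D).map (fun h : G => h⁻¹ • x₀)) :=
    h1.mono_measure (map_restrict_inv_smul_le μ ν h)
  exact h2.comp_of_map (measurable_inv_smul_const x₀).aemeasurable

/-- Integrable functions on `X` are integrable along orbits, locally on `G`. [folklore] -/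
theorem Integrable.comp_inv_smul {x₀ : X} {D : Set G} {C : ℝ≥0∞} (hC : C ≠ ∞)
    (h : ∀ E : Set X, MeasurableSet E → ν (D ∩ invOrbitPreimage x₀ E) ≤ C * μ E)
    {E' : Type*} [NormedAddCommGroup E'] {f : X → E'} (hf : Integrable f μ) :
    IntegrableOn (fun g : G => f (g⁻¹ • x₀)) D ν := by
  rw [← memLp_one_iff_integrable] at hf
  exact memLp_one_iff_integrable.1 (MemLp.comp_inv_smul μ ν hC h hf)

end DominationIntegral

section DominationPackaged

variable {G X : Type*} [Group G] [TopologicalSpace G] [IsTopologicalGroup G]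
  [MeasurableSpace G] [BorelSpace G]
  [MulAction G X] [MeasurableSpace X] [MeasurableSMul₂ G X]
  (μ : Measure X) (ν : Measure G)

section Packaged

variable [TopologicalSpace X] [OpensMeasurableSpace X]
  [IsFiniteMeasure μ] [SFinite ν] [SMulInvariantMeasure G X μ]
  [μ.IsOpenPosMeasure] [ν.IsMulLeftInvariant] [IsFiniteMeasureOnCompacts ν]

/-- **Domination, packaged.** For every compact `Ω ⊆ G` there is a finite constant `C` with
`∫_Ω F(θ h⁻¹ • x₀) dν(h) ≤ C ∫_X F dμ` for all `θ ∈ G` and all measurable `F ≥ 0`. [folklore] -/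
theorem exists_lintegral_smul_inv_smul_le [LocallyCompactSpace G] {x₀ : X}
    (hx₀ : IsOpenMap fun g : G => g • x₀) {Ω : Set G} (hΩ : IsCompact Ω) :
    ∃ C : ℝ≥0∞, C ≠ ∞ ∧ ∀ (θ : G) (F : X → ℝ≥0∞), Measurable F →
      ∫⁻ g in Ω, F (θ • g⁻¹ • x₀) ∂ν ≤ C * ∫⁻ x, F x ∂μ := by
  obtain ⟨C, hC, h⟩ := exists_measure_inter_invOrbitPreimage_le μ ν hx₀ hΩ
  exact ⟨C, hC, fun θ F hF => lintegral_smul_inv_smul_le μ ν h hF θ⟩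

/-- `L^p(μ)`-functions are `L^p(ν)` along open orbits, locally on `G`. [folklore] -/
theorem MemLp.comp_inv_smul_of_isCompact [LocallyCompactSpace G] {x₀ : X}
    (hx₀ : IsOpenMap fun g : G => g • x₀) {D : Set G} (hD : IsCompact D)
    {E' : Type*} [NormedAddCommGroup E'] {p : ℝ≥0∞} {f : X → E'} (hf : MemLp f p μ) :
    MemLp (fun g : G => f (g⁻¹ • x₀)) p (ν.restrict D) := by
  obtain ⟨C, hC, h⟩ := exists_measure_inter_invOrbitPreimage_le μ ν hx₀ hD
  exact MemLp.comp_inv_smul μ ν hC h hf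

end Packaged

end DominationPackaged

/-! ### Orbital smoothing -/

section Smoothing

variable {G X : Type*} [Group G] [MulAction G X] [MeasurableSpace G]
  {𝕜 : Type*} [RCLike 𝕜] {E' : Type*} [NormedAddCommGroup E'] [NormedSpace 𝕜 E']
  [NormedSpace ℝ E']

/-- The **orbital smoothing** of a function `f` on `X` by a weight `η` on `G` with respect to a
measure `ν` on `G`: `S_η f (x) = ∫_G η(g) f(g⁻¹ • x) dν(g)`. For `(R(g) f)(x) = f(g⁻¹ • x)` this is
the pointwise formula for the operator `R(η) = ∫ η(g) R(g) dν(g)` of the integrated regular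
representation (`coeFn_integral_smul_domSMul_ae_eq`). [folklore] -/
def orbitalSmoothing (ν : Measure G) (η : G → 𝕜) (f : X → E') (x : X) : E' :=
  ∫ g, η g • f (g⁻¹ • x) ∂ν

/-- Along an orbit, `S_η f (θ • x₀) = ∫ η(θ h) f(h⁻¹ • x₀) dν(h)` for left-invariant `ν`
(substitute `g = θ h`). [folklore] -/
theorem orbitalSmoothing_smul [MeasurableMul G] (ν : Measure G) [ν.IsMulLeftInvariant]
    (η : G → 𝕜) (f : X → E') (x₀ : X) (θ : G) :
    orbitalSmoothing ν η f (θ • x₀) = ∫ h, η (θ * h) • f (h⁻¹ • x₀) ∂ν := by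
  unfold orbitalSmoothing
  rw [← integral_mul_left_eq_self (fun g => η g • f (g⁻¹ • θ • x₀)) θ]
  congr 1 with h
  rw [mul_inv_rev, smul_smul, inv_mul_cancel_right]

/-- **Orbital smoothing does not see null modifications**: if `f = f'` `μ`-a.e. and `μ`-null sets
pull back to `ν`-null sets along `h ↦ h⁻¹ • x` (the case at every point of an open orbit,
`measure_invOrbitPreimage_eq_zero`), then `S_η f (x) = S_η f' (x)` — at the point `x`, not just
almost everywhere. [folklore] -/
theorem orbitalSmoothing_congr_ae [MeasurableSpace X] {μ : Measure X} (ν : Measure G) (η : G → 𝕜)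
    {f f' : X → E'} (hff' : f =ᵐ[μ] f') {x : X}
    (hx : ∀ E : Set X, MeasurableSet E → μ E = 0 → ν (invOrbitPreimage x E) = 0) :
    orbitalSmoothing ν η f x = orbitalSmoothing ν η f' x := by
  unfold orbitalSmoothing
  refine integral_congr_ae ?_
  have : ∀ᵐ g ∂ν, f (g⁻¹ • x) = f' (g⁻¹ • x) := by
    rw [Filter.EventuallyEq, ae_iff] at hff'
    rw [ae_iff]
    refine measure_mono_null (fun g hg => ?_) (hx _ (measurableSet_toMeasurable μ _)
      ((measure_toMeasurable _).trans hff'))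
    exact subset_toMeasurable μ {a | ¬ f a = f' a} hg
  filter_upwards [this] with g hg
  rw [hg]

variable [TopologicalSpace G] [IsTopologicalGroup G] [BorelSpace G]
  [TopologicalSpace X] [MeasurableSpace X] [OpensMeasurableSpace X] [MeasurableSMul₂ G X]
  (μ : Measure X) (ν : Measure G) [IsFiniteMeasure μ] [SFinite ν] [SMulInvariantMeasure G X μ]
  [μ.IsOpenPosMeasure] [ν.IsMulLeftInvariant] [IsFiniteMeasureOnCompacts ν]

/-- **Continuity of orbital smoothings of integrable functions.** If the orbit map of `x₀` is an
open continuous surjection (so `X` carries the quotient topology of `G`), `η ∈ C_c(G)` and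
`f ∈ L¹(μ)`, then `S_η f` is continuous on `X`. Proof: `S_η f (θ • x₀) = ∫ η(θ h) f(h⁻¹ • x₀) dν(h)`
with `h ↦ f(h⁻¹ • x₀)` integrable on compacts by domination, and dominated convergence in `θ`.
[folklore] -/
theorem continuous_orbitalSmoothing [LocallyCompactSpace G] [FirstCountableTopology G] {x₀ : X}
    (hx₀ : IsOpenMap fun g : G => g • x₀) (hsurj : Function.Surjective fun g : G => g • x₀)
    (hcont : Continuous fun g : G => g • x₀)
    {η : G → 𝕜} (hη : Continuous η) (hηs : HasCompactSupport η) {f : X → E'}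
    (hf : Integrable f μ) : Continuous (orbitalSmoothing ν η f) := by
  have hq : IsQuotientMap fun g : G => g • x₀ := hx₀.isQuotientMap hcont hsurj
  rw [hq.continuous_iff]
  have heq : (orbitalSmoothing ν η f ∘ fun g : G => g • x₀) =
      fun θ => ∫ h, η (θ * h) • f (h⁻¹ • x₀) ∂ν := by
    funext θ; exact orbitalSmoothing_smul ν η f x₀ θ
  rw [heq]
  refine continuous_iff_continuousAt.2 fun θ₀ => ?_
  obtain ⟨M, hM⟩ := hη.bounded_above_of_compact_support hηs
  -- a compact neighbourhood of `θ₀` and a compact set carrying all nearby integrands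
  obtain ⟨Cn, hCnc, hCn⟩ := exists_compact_mem_nhds θ₀
  set K : Set G := tsupport η with hK
  have hKc : IsCompact K := hηs
  set D : Set G := closure (Cn⁻¹ * K) with hD
  have hDc : IsCompact D := (hCnc.inv.mul hKc).closure
  have hDm : MeasurableSet D := isClosed_closure.measurableSet
  obtain ⟨C, hC, hdom⟩ := exists_measure_inter_invOrbitPreimage_le μ ν hx₀ hDc
  have hfD : IntegrableOn (fun g : G => f (g⁻¹ • x₀)) D ν :=
    Integrable.comp_inv_smul μ ν hC hdom hf
  have hsupp : ∀ θ ∈ Cn, ∀ h, η (θ * h) ≠ 0 → h ∈ D := by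
    intro θ hθ h hh
    have : θ * h ∈ K := subset_tsupport _ (Function.mem_support.2 hh)
    exact subset_closure ⟨θ⁻¹, Set.inv_mem_inv.2 hθ, θ * h, this, by simp⟩
  refine continuousAt_of_dominated (bound := fun h => M * D.indicator (fun h => ‖f (h⁻¹ • x₀)‖) h)
    ?_ ?_ ?_ ?_
  · -- measurability of the integrands
    filter_upwards [hCn] with θ hθ
    have h1 : AEStronglyMeasurable (fun h => η (θ * h) • f (h⁻¹ • x₀)) (ν.restrict D) :=
      ((hη.comp (continuous_const.mul continuous_id)).aestronglyMeasurable).smul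
        hfD.aestronglyMeasurable
    have h2 : (fun h => η (θ * h) • f (h⁻¹ • x₀)) =
        D.indicator (fun h => η (θ * h) • f (h⁻¹ • x₀)) := by
      funext h
      by_cases hh : h ∈ D
      · rw [indicator_of_mem hh]
      · rw [indicator_of_notMem hh]
        have : η (θ * h) = 0 := by
          by_contra hne; exact hh (hsupp θ hθ h hne)
        rw [this, zero_smul]
    rw [h2]
    exact (aestronglyMeasurable_indicator_iff hDm).2 h1
  · -- the uniform bound near `θ₀`
    filter_upwards [hCn] with θ hθ
    refine Eventually.of_forall fun h => ?_
    by_cases hh : h ∈ D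
    · rw [indicator_of_mem hh, norm_smul]
      exact mul_le_mul_of_nonneg_right (hM _) (norm_nonneg _)
    · have : η (θ * h) = 0 := by
        by_contra hne; exact hh (hsupp θ hθ h hne)
      rw [this, zero_smul, norm_zero, indicator_of_notMem hh, mul_zero]
  · -- integrability of the bound
    have hn : IntegrableOn (fun h : G => ‖f (h⁻¹ • x₀)‖) D ν := hfD.norm
    exact (hn.integrable_indicator hDm).const_mul M
  · -- continuity in `θ`
    refine Eventually.of_forall fun h => ?_
    exact ((hη.comp (continuous_id.mul continuous_const)).smul continuous_const).continuousAt

end Smoothing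

/-! ### Integrability, the pairing identity and the `L²`-valued Bochner integral -/

section Pairing

variable {G X : Type*} [Group G] [TopologicalSpace G] [MeasurableSpace G] [OpensMeasurableSpace G]
  [MeasurableInv G]
  [MulAction G X] [MeasurableSpace X] [MeasurableSMul₂ G X]
  {𝕜 : Type*} [RCLike 𝕜]
  (μ : Measure X) (ν : Measure G) [SFinite μ] [SFinite ν] [SMulInvariantMeasure G X μ]

omit [TopologicalSpace G] [OpensMeasurableSpace G] in
/-- The map `(x, g) ↦ g⁻¹ • x` is quasi-measure-preserving from `μ ⊗ ν` to `μ` (its pushforward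
of `μ ⊗ ν` is `ν(G) · μ`). [folklore] -/
theorem quasiMeasurePreserving_inv_smul_prod :
    QuasiMeasurePreserving (fun p : X × G => p.2⁻¹ • p.1) (μ.prod ν) μ := by
  have hT : Measurable fun p : X × G => p.2⁻¹ • p.1 :=
    measurable_smul.comp ((measurable_inv.comp measurable_snd).prodMk measurable_fst)
  refine ⟨hT, Measure.AbsolutelyContinuous.mk fun s hs hs0 => ?_⟩
  rw [map_apply hT hs, prod_apply_symm (hT hs)]
  have : ∀ g : G, μ ((fun x : X => (x, g)) ⁻¹' ((fun p : X × G => p.2⁻¹ • p.1) ⁻¹' s)) = μ s :=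
    fun g => measure_preimage_smul μ g⁻¹ s
  simp_rw [this, hs0, lintegral_zero]

variable [IsFiniteMeasureOnCompacts ν]

/-- The integrand `(x, g) ↦ η(g) f(g⁻¹ • x)` of an orbital smoothing is integrable on `X × G` for
`f ∈ L¹(μ)` and `η ∈ C_c(G)`: by Tonelli and invariance of `μ` its `L¹` norm is `‖η‖₁ ‖f‖₁`.
[folklore] -/
theorem integrable_uncurry_smul_comp_inv_smul {E' : Type*} [NormedAddCommGroup E']
    [NormedSpace 𝕜 E'] {η : G → 𝕜} (hη : Continuous η)
    (hηs : HasCompactSupport η) {f : X → E'} (hf : Integrable f μ) :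
    Integrable (Function.uncurry fun (x : X) (g : G) => η g • f (g⁻¹ • x)) (μ.prod ν) := by
  have hfg : ∀ g : G, Integrable (fun x => f (g⁻¹ • x)) μ := fun g =>
    ((measurePreserving_smul g⁻¹ μ).integrable_comp hf.1).2 hf
  have hnorm : ∀ g : G, ∫ x, ‖f (g⁻¹ • x)‖ ∂μ = ∫ x, ‖f x‖ ∂μ := fun g =>
    (measurePreserving_smul g⁻¹ μ).integral_comp
      (MeasurableEquiv.smul (g⁻¹ : G)).measurableEmbedding (fun x => ‖f x‖)
  have hFm : AEStronglyMeasurable (Function.uncurry fun (x : X) (g : G) => η g • f (g⁻¹ • x))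
      (μ.prod ν) := by
    have h2 : AEStronglyMeasurable (fun p : X × G => η p.2) (μ.prod ν) :=
      (hη.measurable.comp measurable_snd).aestronglyMeasurable
    have h3 : AEStronglyMeasurable (fun p : X × G => f (p.2⁻¹ • p.1)) (μ.prod ν) :=
      hf.1.comp_quasiMeasurePreserving (quasiMeasurePreserving_inv_smul_prod μ ν)
    exact h2.smul h3
  rw [integrable_prod_iff' hFm]
  constructor
  · exact Eventually.of_forall fun g => (hfg g).smul (η g)
  · have hηi : Integrable (fun g => ‖η g‖ * ∫ x, ‖f x‖ ∂μ) ν :=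
      (hη.integrable_of_hasCompactSupport hηs).norm.mul_const _
    refine hηi.mono' hFm.prod_swap.norm.integral_prod_right' (Eventually.of_forall fun g => ?_)
    rw [Real.norm_of_nonneg (integral_nonneg fun _ => norm_nonneg _)]
    have : (fun x => ‖Function.uncurry (fun (x : X) (g : G) => η g • f (g⁻¹ • x)) (x, g)‖) =
        fun x => ‖η g‖ * ‖f (g⁻¹ • x)‖ := by
      funext x; simp only [Function.uncurry_apply_pair, norm_smul]
    rw [this, integral_const_mul, hnorm g]

/-- **Orbital smoothings of integrable functions are integrable**: `S_η f ∈ L¹(μ)` for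
`f ∈ L¹(μ)`, `η ∈ C_c(G)` (with `‖S_η f‖₁ ≤ ‖η‖₁ ‖f‖₁`). [folklore] -/
theorem integrable_orbitalSmoothing {E' : Type*} [NormedAddCommGroup E'] [NormedSpace 𝕜 E']
    [NormedSpace ℝ E'] {η : G → 𝕜} (hη : Continuous η)
    (hηs : HasCompactSupport η) {f : X → E'} (hf : Integrable f μ) :
    Integrable (orbitalSmoothing ν η f) μ :=
  (integrable_uncurry_smul_comp_inv_smul μ ν hη hηs hf).integral_prod_left

/-- **Pairing identity for orbital smoothings of `L²` functions**:
`∫ ψ · S_η f dμ = ∫ η(g) (∫ ψ(x) f(g⁻¹ • x) dμ(x)) dν(g)` for `f, ψ ∈ L²(μ)` and `η ∈ C_c(G)`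
(Fubini; the integrand is absolutely integrable with bound `‖η‖₁ ‖ψ‖₂ ‖f‖₂` by Hölder and the
invariance of `μ`). With `ψ ↦ conj ψ` this is `⟪ψ, S_η f⟫ = ∫ η(g) ⟪ψ, R(g) f⟫ dν(g)`. [folklore] -/
theorem integral_mul_orbitalSmoothing {η : G → 𝕜} (hη : Continuous η) (hηs : HasCompactSupport η)
    {f ψ : X → 𝕜} (hf : MemLp f 2 μ) (hψ : MemLp ψ 2 μ) :
    ∫ x, ψ x * orbitalSmoothing ν η f x ∂μ = ∫ g, η g * ∫ x, ψ x * f (g⁻¹ • x) ∂μ ∂ν := by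
  set F : X → G → 𝕜 := fun x g => ψ x * (η g * f (g⁻¹ • x)) with hF_def
  have hfg : ∀ g : G, MemLp (fun x => f (g⁻¹ • x)) 2 μ := fun g =>
    hf.comp_measurePreserving (measurePreserving_smul g⁻¹ μ)
  have hnorm : ∀ g : G, eLpNorm (fun x => f (g⁻¹ • x)) 2 μ = eLpNorm f 2 μ := fun g =>
    eLpNorm_comp_measurePreserving hf.1 (measurePreserving_smul g⁻¹ μ)
  -- Hölder: `x ↦ ψ x * f (g⁻¹ • x)` is in `L¹` with norm at most `‖ψ‖₂ ‖f‖₂`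
  have hprod : ∀ g : G, MemLp (fun x => ψ x * f (g⁻¹ • x)) 1 μ := fun g => (hfg g).mul' hψ
  set M : ℝ := (eLpNorm ψ 2 μ * eLpNorm f 2 μ).toReal with hM
  have hMfin : eLpNorm ψ 2 μ * eLpNorm f 2 μ ≠ ∞ := ENNReal.mul_ne_top hψ.2.ne hf.2.ne
  have hL1 : ∀ g : G, ∫ x, ‖ψ x * f (g⁻¹ • x)‖ ∂μ ≤ M := by
    intro g
    rw [integral_norm_eq_lintegral_enorm (hprod g).1, ← eLpNorm_one_eq_lintegral_enorm, hM]
    refine ENNReal.toReal_mono hMfin ?_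
    calc eLpNorm (fun x => ψ x * f (g⁻¹ • x)) 1 μ
        ≤ (1 : ℝ≥0) * eLpNorm ψ 2 μ * eLpNorm (fun x => f (g⁻¹ • x)) 2 μ :=
          eLpNorm_le_eLpNorm_mul_eLpNorm'_of_norm hψ.1 (hfg g).1 (· * ·) 1
            (Eventually.of_forall fun x => by simp)
      _ = eLpNorm ψ 2 μ * eLpNorm f 2 μ := by rw [hnorm g, ENNReal.coe_one, one_mul]
  -- measurability of the integrand on the product
  have hFm : AEStronglyMeasurable (Function.uncurry F) (μ.prod ν) := by
    have h1 : AEStronglyMeasurable (fun p : X × G => ψ p.1) (μ.prod ν) :=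
      hψ.1.comp_quasiMeasurePreserving quasiMeasurePreserving_fst
    have h2 : AEStronglyMeasurable (fun p : X × G => η p.2) (μ.prod ν) :=
      (hη.measurable.comp measurable_snd).aestronglyMeasurable
    have h3 : AEStronglyMeasurable (fun p : X × G => f (p.2⁻¹ • p.1)) (μ.prod ν) :=
      hf.1.comp_quasiMeasurePreserving (quasiMeasurePreserving_inv_smul_prod μ ν)
    exact h1.mul (h2.mul h3)
  -- integrability on the product (Tonelli bound `‖η‖₁ ‖ψ‖₂ ‖f‖₂`)
  have hFi : Integrable (Function.uncurry F) (μ.prod ν) := by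
    rw [integrable_prod_iff' hFm]
    constructor
    · refine Eventually.of_forall fun g => ?_
      have : (fun x => Function.uncurry F (x, g)) = fun x => η g * (ψ x * f (g⁻¹ • x)) := by
        funext x; simp only [Function.uncurry_apply_pair, hF_def]; ring
      rw [this]
      exact (memLp_one_iff_integrable.1 (hprod g)).const_mul _
    · have hηi : Integrable (fun g => ‖η g‖ * M) ν :=
        (hη.integrable_of_hasCompactSupport hηs).norm.mul_const M
      refine hηi.mono' hFm.prod_swap.norm.integral_prod_right' (Eventually.of_forall fun g => ?_)
      rw [Real.norm_of_nonneg (integral_nonneg fun _ => norm_nonneg _)]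
      have : (fun x => ‖Function.uncurry F (x, g)‖) = fun x => ‖η g‖ * ‖ψ x * f (g⁻¹ • x)‖ := by
        funext x
        simp only [Function.uncurry_apply_pair, hF_def, norm_mul]
        ring
      rw [this, integral_const_mul]
      exact mul_le_mul_of_nonneg_left (hL1 g) (norm_nonneg _)
  -- the computation
  calc ∫ x, ψ x * orbitalSmoothing ν η f x ∂μ
      = ∫ x, ∫ g, F x g ∂ν ∂μ := by
        congr 1 with x
        simp only [orbitalSmoothing, smul_eq_mul, hF_def]
        exact (integral_const_mul (ψ x) _).symm
    _ = ∫ g, ∫ x, F x g ∂μ ∂ν := integral_integral_swap hFi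
    _ = ∫ g, η g * ∫ x, ψ x * f (g⁻¹ • x) ∂μ ∂ν := by
        congr 1 with g
        rw [← integral_const_mul]
        congr 1 with x
        simp only [hF_def]
        ring

/-- **The `L²`-valued Bochner integral of translates is the orbital smoothing.** For
`f ∈ L²(μ)` (`μ` finite) and `η ∈ C_c(G)`, the Bochner integral `∫ η(g) • (g · f) dν(g)` computed
in the Hilbert space `L²(μ)` — `g · f = DomMulAct.mk g⁻¹ • f` being Mathlib's domain action,
`(g · f)(x) = f(g⁻¹ • x)` a.e. (`DomMulAct.smul_Lp_ae_eq`), i.e. the regular representation — has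
`S_η f` as a representative. (The measurability hypothesis `hF` holds when the regular
representation is strongly continuous.) Consequently `S_η f ∈ L²(μ)`, and it lies in every closed
invariant subspace containing `f`. [folklore] -/
theorem coeFn_integral_smul_domSMul_ae_eq [IsFiniteMeasure μ] {η : G → 𝕜} (hη : Continuous η)
    (hηs : HasCompactSupport η) (f : Lp 𝕜 2 μ)
    (hF : AEStronglyMeasurable (fun g : G => (DomMulAct.mk g⁻¹ • f : Lp 𝕜 2 μ)) ν) :
    ((∫ g, η g • (DomMulAct.mk g⁻¹ • f : Lp 𝕜 2 μ) ∂ν : Lp 𝕜 2 μ) : X → 𝕜) =ᵐ[μ]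
      orbitalSmoothing ν η f := by
  have hf2 : MemLp (f : X → 𝕜) 2 μ := Lp.memLp f
  have hf1 : Integrable (f : X → 𝕜) μ := hf2.integrable one_le_two
  -- integrability of the `L²`-valued integrand
  have hI : Integrable (fun g : G => η g • (DomMulAct.mk g⁻¹ • f : Lp 𝕜 2 μ)) ν := by
    refine ⟨hη.aestronglyMeasurable.smul hF, ?_⟩
    have hb : Integrable (fun g => ‖η g‖ * ‖f‖) ν :=
      (hη.integrable_of_hasCompactSupport hηs).norm.mul_const _
    refine hb.2.mono (Eventually.of_forall fun g => ?_)
    simp only [norm_smul, DomMulAct.norm_smul_Lp, Real.norm_of_nonneg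
      (mul_nonneg (norm_nonneg _) (norm_nonneg _)), le_rfl]
  set T : Lp 𝕜 2 μ := ∫ g, η g • (DomMulAct.mk g⁻¹ • f : Lp 𝕜 2 μ) ∂ν with hT
  have hTi : Integrable (T : X → 𝕜) μ := (Lp.memLp T).integrable one_le_two
  have hSi : Integrable (orbitalSmoothing ν η (f : X → 𝕜)) μ :=
    integrable_orbitalSmoothing μ ν hη hηs hf1
  refine hTi.ae_eq_of_forall_setIntegral_eq _ _ hSi fun A hA hμA => ?_
  -- test against the indicator of `A`
  have hind : MemLp (A.indicator fun _ => (1 : 𝕜)) 2 μ :=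
    memLp_indicator_const 2 hA 1 (Or.inr hμA.ne)
  calc ∫ x in A, (T : X → 𝕜) x ∂μ
      = inner 𝕜 (indicatorConstLp 2 hA hμA.ne (1 : 𝕜)) T :=
        (L2.inner_indicatorConstLp_one hA hμA.ne T).symm
    _ = ∫ g, inner 𝕜 (indicatorConstLp 2 hA hμA.ne (1 : 𝕜))
          (η g • (DomMulAct.mk g⁻¹ • f : Lp 𝕜 2 μ)) ∂ν := by
        rw [hT, ← integral_inner hI]
    _ = ∫ g, η g * ∫ x, A.indicator (fun _ => (1 : 𝕜)) x * (f : X → 𝕜) (g⁻¹ • x) ∂μ ∂ν := by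
        congr 1 with g
        rw [inner_smul_right, L2.inner_indicatorConstLp_one]
        congr 1
        rw [← integral_indicator hA]
        refine integral_congr_ae ?_
        filter_upwards [DomMulAct.smul_Lp_ae_eq (DomMulAct.mk g⁻¹) f] with x hx
        by_cases hxA : x ∈ A
        · simp only [indicator_of_mem hxA, one_mul, hx, Equiv.symm_apply_apply]
        · simp only [indicator_of_notMem hxA, zero_mul]
    _ = ∫ x, A.indicator (fun _ => (1 : 𝕜)) x * orbitalSmoothing ν η (f : X → 𝕜) x ∂μ :=
        (integral_mul_orbitalSmoothing μ ν hη hηs hf2 hind).symm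
    _ = ∫ x in A, orbitalSmoothing ν η (f : X → 𝕜) x ∂μ := by
        rw [← integral_indicator hA]
        congr 1 with x
        by_cases hxA : x ∈ A
        · simp only [indicator_of_mem hxA, one_mul]
        · simp only [indicator_of_notMem hxA, zero_mul]

end Pairing

/-! ### Coset spaces `G ⧸ H`: every orbit map is an open continuous surjection -/

section Quotient

variable {G : Type*} [Group G] [TopologicalSpace G] [IsTopologicalGroup G] (H : Subgroup G)

/-- On a coset space `G ⧸ H` (any subgroup `H`, Mathlib's left action `g • qH = (gq)H`) every orbit
map `g ↦ g • x₀` is open: it is the open quotient map composed with a right translation.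
[folklore] -/
theorem isOpenMap_smul_quotient (x₀ : G ⧸ H) : IsOpenMap fun g : G => g • x₀ := by
  induction x₀ using QuotientGroup.induction_on with
  | H q =>
    have : (fun g : G => g • (q : G ⧸ H)) = (QuotientGroup.mk : G → G ⧸ H) ∘ fun g => g * q := by
      funext g; rfl
    rw [this]
    exact QuotientGroup.isOpenMap_coe.comp (isOpenMap_mul_right q)

/-- Every orbit map of a coset space is continuous. [folklore] -/
theorem continuous_smul_quotient (x₀ : G ⧸ H) : Continuous fun g : G => g • x₀ := by
  induction x₀ using QuotientGroup.induction_on with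
  | H q =>
    have : (fun g : G => g • (q : G ⧸ H)) = (QuotientGroup.mk : G → G ⧸ H) ∘ fun g => g * q := by
      funext g; rfl
    rw [this]
    exact QuotientGroup.continuous_mk.comp (continuous_id.mul continuous_const)

omit [TopologicalSpace G] [IsTopologicalGroup G] in
/-- Every orbit map of a coset space is surjective (the action is transitive). [folklore] -/
theorem surjective_smul_quotient (x₀ : G ⧸ H) : Function.Surjective fun g : G => g • x₀ := by
  induction x₀ using QuotientGroup.induction_on with
  | H q =>
    intro y
    induction y using QuotientGroup.induction_on with
    | H r => exact ⟨r * q⁻¹, by change ((r * q⁻¹ * q : G) : G ⧸ H) = r; rw [inv_mul_cancel_right]⟩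

end Quotient

end Literature.NumberTheory.Automorphic
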